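import Summits.RiemannHypothesis.RiemannHypothesis.Theorems.JensenPolynomialsSqrtLogRange
import Literature.NumberTheory.LFunctions.JensenShiftCertificate

/-!
# Rung J-P(P1″) «√d·log d range» — the EXPLICIT threshold: `J^{d,n}_γ` is hyperbolic for every `d`
# and every `n ≥ 40·√d·log(20·√d)`, i.e. `N(d) ≤ 20√d·log d + 120√d` (RH-FREE proof-of-data; cell
# rh-jensen, HUMAN RULING D-0040, ladder RH column JENSEN)

RH-FREE. The leaf `JensenSqrtLogRangeTwenty` (`n ≥ 20 000 ∧ 20·√d·log n ≤ n ⇒ J^{d,n}_γ hyperbolic`,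
proved in `JensenPolynomialsSqrtLogRange.lean`) has its hypothesis implicit in `n`. This file inverts
it into the ladder's sentence «`n ≥ C·√d·log d` with explicit `C`» (LADDER-RH J-P(P3b) as worded by
planner-rh-jensen-theory-g7-0, 2026-08-26):

* `jensenPoly_xiTaylorCoeff_splits_of_ge` : for ALL `d n : ℕ`, `40·√d·log(20·√d) ≤ n ⇒ J^{d,n}_γ`
  hyperbolic (no side condition: for `d ≤ 10⁶` every shift is the tree's kernel certificate
  `jensenPoly_xiTaylorCoeff_splits_allShifts_of_le_1e6'`; for `d > 10⁶`, `y = 20√d > 20 000` and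
  `n ≥ 2y·log y` gives `n ≥ 20 000` and, by the antitonicity of `log x / x` on `[e, ∞)`
  (`Real.log_div_self_antitoneOn`) together with `2 log y ≤ y`, `y·log n ≤ n`);
* `jensenPoly_xiTaylorCoeff_splits_of_ge'` : the same with the threshold `20·√d·(log d + 6)`
  (`log 20 < 3`);
* `jensenHyperbolicFrom_xiTaylorCoeff_sqrtLog` : `JensenHyperbolicFrom xiTaylorCoeff d ⌈40·√d·log(20·√d)⌉₊`
  for every `d` — the column's `N(d)`: GORZ 2019 Thm. 1 (`∃ N(d)`), GORTTW 2022 Thm. 1.1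
  (`n ≥ c·e^{d}`, `gorttw_thm1_1`), the first rung `JensenCubicRangeTwo` (`n ≥ 2d³`), Kim–Lee 2021
  Thm. 1 (`O(d^{1/2+ε})`, ineffective, `kimLee_thm1`) — now `N(d) ≤ 40√d·log(20√d)`.

WHAT THIS IS NOT: a hyperbolicity range `n ≥ N(d)` with `N(d) → ∞` carries no information about RH
(Farmer 2022; tree barriers `Literature.Barriers.RiemannHypothesis.JensenPolynomials{,ShiftUniform,Sqrt,Cone}`);
nothing here bears on zeros of `ζ` off the critical line or on the truth of RH. Inputs: the leaf
(idea-2 g0's reduction + prover-rh-jensen-eng-2-g4-0's effective Kim–Lee radius, this seat's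
assembly) and the tree's `d ≤ 10⁶` certificate. Landed `--supports stmt-RiemannHypothesis-19715` by
prover-rh-jensen-prover-g6-0.

## References
* [KimLee2021] Y.-O. Kim, J. Lee, *A note on the zeros of Jensen polynomials*, J. Korean Math. Soc.
  59 (2022) 775–787 = arXiv:2105.05386, Thm. 1.
* [GORZPNAS2019] Griffin–Ono–Rolen–Zagier, PNAS 116 (2019) 11103–11110, Thm. 1.
* [GriffinEtAl2022] Griffin–Ono–Rolen–Thorner–Tripp–Wagner, Adv. Math. 397 (2022), Thm. 1.1.
-/

noncomputable section
-- D-0017: `Summit.RiemannHypothesis.RiemannHypothesis.…` duplicates the namespace BY DESIGN (single-problem summit).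
set_option linter.dupNamespace false

open Polynomial

namespace Summit.RiemannHypothesis.RiemannHypothesis.Theorems.JensenPolynomials.KimLee

open Literature.NumberTheory.LFunctions

/-- The inversion step: for `y ≥ 2` (so that `2y log y ≥ e`) and `n ≥ 2y·log y`, one has `y·log n ≤ n`
(antitonicity of `log x / x` on `[e, ∞)` and `2 log y ≤ y`). [folklore] -/
theorem mul_log_le_of_ge {y n : ℝ} (hy : 2 ≤ y) (hn : 2 * y * Real.log y ≤ n) : y * Real.log n ≤ n := by
  have hy0 : 0 < y := by linarith
  have hlogy : Real.log 2 ≤ Real.log y := Real.log_le_log (by norm_num) hy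
  have hl2 : 0.6931471803 < Real.log 2 := Real.log_two_gt_d9
  have hlogy0 : 0 < Real.log y := by linarith
  set n₀ : ℝ := 2 * y * Real.log y with hn₀
  have hn₀pos : 0 < n₀ := by positivity
  -- `e ≤ n₀`: `n₀ ≥ 4 log 2 > 2.77 > e`
  have he : Real.exp 1 ≤ n₀ := by
    have h1 : Real.exp 1 < 2.7182818286 := Real.exp_one_lt_d9
    have h2 : 4 * Real.log 2 ≤ n₀ := by rw [hn₀]; nlinarith
    linarith
  have hn0 : 0 < n := lt_of_lt_of_le hn₀pos hn
  -- antitone: `log n / n ≤ log n₀ / n₀`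
  have hanti := Real.log_div_self_antitoneOn (Set.mem_Ici.2 he) (Set.mem_Ici.2 (he.trans hn)) hn
  simp only at hanti
  -- `log n₀ ≤ 2 log y` since `n₀ ≤ y²` (`2 log y ≤ y`, from `log(y/2) ≤ y/2 − 1`, `log 2 < 1`;
  -- cf. `Literature.NumberTheory.LFunctions.LittlewoodRH.two_mul_log_le`)
  have h2log : 2 * Real.log y ≤ y := by
    have h1 : Real.log (y / 2) ≤ y / 2 - 1 := Real.log_le_sub_one_of_pos (by positivity)
    have h2 : Real.log (y / 2) = Real.log y - Real.log 2 := by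
      rw [Real.log_div hy0.ne' (by norm_num)]
    have h3 : Real.log 2 < 1 := by
      have := Real.log_two_lt_d9; linarith
    linarith
  have hn₀y : n₀ ≤ y ^ 2 := by
    rw [hn₀]; nlinarith [h2log]
  have hlogn₀ : Real.log n₀ ≤ 2 * Real.log y := by
    have h2 : Real.log (y ^ 2) = 2 * Real.log y := by
      rw [Real.log_pow]; norm_num
    rw [← h2]
    exact Real.log_le_log hn₀pos hn₀y
  -- `y log n₀ ≤ n₀`
  have hkey : y * Real.log n₀ ≤ n₀ := by
    calc y * Real.log n₀ ≤ y * (2 * Real.log y) := mul_le_mul_of_nonneg_left hlogn₀ hy0.le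
      _ = n₀ := by rw [hn₀]; ring
  -- conclude: `y log n = y n (log n / n) ≤ y n (log n₀ / n₀) ≤ n`
  have h1 : Real.log n ≤ n * (Real.log n₀ / n₀) := by
    have := mul_le_mul_of_nonneg_left hanti hn0.le
    rwa [mul_div_cancel₀ _ hn0.ne'] at this
  calc y * Real.log n ≤ y * (n * (Real.log n₀ / n₀)) := mul_le_mul_of_nonneg_left h1 hy0.le
    _ = n * (y * Real.log n₀ / n₀) := by ring
    _ ≤ n * 1 := by
        apply mul_le_mul_of_nonneg_left _ hn0.le
        rw [div_le_one hn₀pos]; exact hkey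
    _ = n := mul_one n

/-- **EXPLICIT √d·log d RANGE (RH-FREE): for all `d, n` with `40·√d·log(20·√d) ≤ n`, `J^{d,n}_γ` is
hyperbolic** — the effective Kim–Lee threshold `N(d) ≤ 40√d·log(20√d) = 20√d·log d + 119.8…·√d`.
Degrees `d ≤ 10⁶`: every shift, by the tree's certificate; `d > 10⁶`: the leaf
`JensenSqrtLogRangeTwenty` with `y = 20√d ≥ 20 000`, `n ≥ 2y log y ⇒ n ≥ 20 000 ∧ y log n ≤ n`.
[cite: KimLee2021, Theorem 1] -/
theorem jensenPoly_xiTaylorCoeff_splits_of_ge (d n : ℕ)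
    (hn : 40 * Real.sqrt d * Real.log (20 * Real.sqrt d) ≤ n) :
    (jensenPoly xiTaylorCoeff d n).Splits := by
  by_cases hd : d ≤ 1000000
  · exact jensenPoly_xiTaylorCoeff_splits_allShifts_of_le_1e6' hd n
  · push Not at hd
    have hd' : (1000000 : ℝ) ≤ d := by exact_mod_cast hd.le
    have hsd : (1000 : ℝ) ≤ Real.sqrt d := by
      rw [show (1000 : ℝ) = Real.sqrt (1000 ^ 2) by rw [Real.sqrt_sq (by norm_num)]]
      exact Real.sqrt_le_sqrt (by linarith)
    set y : ℝ := 20 * Real.sqrt d with hy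
    have hy2 : (20000 : ℝ) ≤ y := by rw [hy]; linarith
    have hn' : 2 * y * Real.log y ≤ n := by rw [hy]; linarith
    -- `n ≥ 20000`: `2 y log y ≥ 2 · 20000 · 9`
    have hlogy : 9 ≤ Real.log y := nine_le_log_20000.trans (Real.log_le_log (by norm_num) hy2)
    have hn20000 : (20000 : ℝ) ≤ n := by nlinarith
    have hnN : 20000 ≤ n := by exact_mod_cast hn20000
    refine jensenSqrtLogRangeTwenty_holds d n hnN ?_
    have := mul_log_le_of_ge (by linarith : (2 : ℝ) ≤ y) hn'
    rw [hy] at this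
    linarith

/-- The same range with the simpler threshold **`20·√d·(log d + 6)`** (since `log 20 < 3`): for all
`d ≥ 1` and `n ≥ 20√d(log d + 6)`, `J^{d,n}_γ` is hyperbolic. [cite: KimLee2021, Theorem 1] -/
theorem jensenPoly_xiTaylorCoeff_splits_of_ge' (d n : ℕ) (hd : 1 ≤ d)
    (hn : 20 * Real.sqrt d * (Real.log d + 6) ≤ n) :
    (jensenPoly xiTaylorCoeff d n).Splits := by
  refine jensenPoly_xiTaylorCoeff_splits_of_ge d n (le_trans ?_ hn)
  have hd0 : (0 : ℝ) < d := by exact_mod_cast hd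
  have hsd : 0 < Real.sqrt d := Real.sqrt_pos.2 hd0
  have hlog : Real.log (20 * Real.sqrt d) = Real.log 20 + Real.log d / 2 := by
    rw [Real.log_mul (by norm_num) hsd.ne', Real.sqrt_eq_rpow, Real.log_rpow hd0]; ring
  have h20 : Real.log 20 < 3 := by
    rw [Real.log_lt_iff_lt_exp (by norm_num)]
    have h1 : (2.7182818283 : ℝ) < Real.exp 1 := Real.exp_one_gt_d9
    have h3 : Real.exp 3 = Real.exp 1 ^ 3 := by rw [← Real.exp_nat_mul]; norm_num
    rw [h3]
    have : (2.7182818283 : ℝ) ^ 3 ≤ Real.exp 1 ^ 3 := pow_le_pow_left₀ (by norm_num) h1.le 3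
    nlinarith
  rw [hlog]
  nlinarith [hsd, Real.log_nonneg (show (1 : ℝ) ≤ d by exact_mod_cast hd)]

/-- **The column's `N(d)`, explicit (RH-FREE):** `JensenHyperbolicFrom xiTaylorCoeff d ⌈40√d·log(20√d)⌉₊`
for every degree `d` — all Jensen polynomials `J^{d,n}_γ` with `n ≥ ⌈40√d·log(20√d)⌉` are hyperbolic
(GORZ 2019 Thm. 1: `∃ N(d)`; GORTTW 2022: `N(d) ≤ c·e^{d}`; rung J-P(P1′): `N(d) ≤ 2d³`; Kim–Lee 2021:
`O(d^{1/2+ε})` ineffective; here `N(d) = O(√d log d)` explicit).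
[cite: KimLee2021, Theorem 1] [cite: GORZPNAS2019, Thm. 1] -/
theorem jensenHyperbolicFrom_xiTaylorCoeff_sqrtLog (d : ℕ) :
    JensenHyperbolicFrom xiTaylorCoeff d ⌈40 * Real.sqrt d * Real.log (20 * Real.sqrt d)⌉₊ := by
  intro n hn
  refine jensenPoly_xiTaylorCoeff_splits_of_ge d n ?_
  have h1 := Nat.le_ceil (40 * Real.sqrt d * Real.log (20 * Real.sqrt d))
  have h2 : ((⌈40 * Real.sqrt d * Real.log (20 * Real.sqrt d)⌉₊ : ℕ) : ℝ) ≤ n := by exact_mod_cast hn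
  linarith

end Summit.RiemannHypothesis.RiemannHypothesis.Theorems.JensenPolynomials.KimLee

end
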